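/-
Copyright (c) 2026 the pub-hodgecm-mathlib formalisation cell (harness21).  Prover seat hodgecm-mathlib-LH4-p10 (g9) (valve hand), Track B «K2-LIT»,
#184♮ = hLiu418 = `stmt-HodgeConjecture-24832`; socket #41, KIND W — LEAD F0P6-plan (g15) BATCH #200 2026-09-05T00:50:38Z «(KW-arch-hW-hol)
`K2LiuKindWArchWhittakerHolomorphy :: hWhol_of_std` = the PAYER of the ONE by-value analytic letter `hWhol` of K2E3-p11 (g10)'s dispatcher
`K2LiuKindWArchWhittakerLetterDispatch :: hW_of_signCases`»; KW desk F0P2-p08 (g3) ruling (G1) road (α) (flat family + parametric holomorphy).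
THEOREMS ONLY (no `def`, no `instance`, no notation, no named-fact hypothesis, no `sorry`, default heartbeats).
-/
import Summits.HodgeConjecture.HodgeConjecture.Theorems.K2LiuArchKFiniteSectionMajorised          -- ★ (H2-an) FILE 2: `exists_norm_apply_le`, `continuousOn_UJ`, `norm_det_eq_one_of_unitary`
import Summits.HodgeConjecture.HodgeConjecture.Theorems.K2LiuArchIntertwiningLieDerivativePrelims  -- ★ (L-i)+(L-ii): `denom_transl_eq_mul`, `continuous_hermOfReal`, Majorant
import Summits.HodgeConjecture.HodgeConjecture.Theorems.K2LiuHermTwoConfluentXiDefs                 -- ★ `trace_mul_hermTwo_of_isHermitian`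
import Literature.Dynamics.TransferOperators.MayerTransferOperatorHolomorphy                    -- ★ `rpow_neg_le_add`
import Mathlib.Analysis.Calculus.ParametricIntegral
import Mathlib.Analysis.SpecialFunctions.Pow.Deriv
import HarnessLib

/-!
# Crux `HLiu418`, socket #41, KIND W — `K2LiuKindWArchWhittakerHolomorphy`: the FLAT FAMILY through a Siegel section and the HOLOMORPHY of its twisted
# big-cell integral on the region of absolute convergence (the by-value letter `hWhol` of ★ `K2LiuKindWArchWhittakerLetterDispatch.hW_of_signCases`)

Cell `hodgecm-mathlib`, crux item hLiu418 = `stmt-HodgeConjecture-24832` (helper lane `--supports … --as helper`, count-neutral); KW line, valve hand LH4-p10 (g9),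
KW desk F0P2-p08 (g3) (GO 00:58:08Z), consumer K2E3-p11 (g10).  THE LETTER PAID (the dispatcher's `hWhol` binder, generic index types, every abscissa `s₁ ≥ ½`):
for `good S`, `h`, `w`, a compact picture `Q`, `s′` with `s₁ < re s′` and a section `F₀ ∈ I_w(s′, χ_{k w})` of picture `Q`, there is a family `G s ∈ I_w(s, χ_{k w})` of
picture `Q` whose twisted big-cell integral `s ↦ ∫_r G s ((0 B_w; C_w 0)·n(hermOfReal r)·Pt S h w)·eb S h w (hermOfReal r) dr` is holomorphic on `{s₁ < re}`.
ROAD ((G1) road (α)).  §1 `|log x| ≤ (x^η + x^{−η})∕η` (+ ★ Lit `rpow_neg_le_add`).  §2 THE FLAT FAMILY `G s y := ‖j(y, i1)‖^{2(s′−s)}·F₀ y` is a section at `s`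
(`isArchSiegelSection_flat`: `j(p g, i1) = det p₂₂·j(g, i1)`, `‖det p₂₂‖ = ‖det p₁₁‖⁻¹` — ★ `det_denom_mul_of_siegel`, ★ `det_toBlocks₂₂_of_mem_siegel`)
with the same picture (`flat_kU`).  §3 at the frame `y_r = x·n(hermOfReal r)·g` (`x = (0 B; C 0)`, `g ∈ U(J)`):
`‖j(y_r, i1)‖ = ‖det C‖·‖det(hermOfReal r + Z)‖·‖det d‖` (★ `denom_transl_eq_mul`), so `‖j(y_r,i1)‖^{−t}` is integrable for `t > 3` (★ (L-ii) `integrable_norm_det_hermOfReal_add_rpow_neg`);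
the twist is unimodular (★ `trace_mul_hermTwo_of_isHermitian`).
§4 DIFFERENTIATION UNDER THE INTEGRAL SIGN (Mathlib `hasDerivAt_integral_of_dominated_loc_of_deriv_le`), abstractly: with ★ FILE 2's majorant `‖F₀ y‖ ≤ C‖j(y,i1)‖^{−(2σ′+2)}`
the integrand is `O(a^{−(2σ+2)})`, its `s`-derivative `O(|log a|·a^{−(2σ+2)})`, dominated on `ball s₀ ε` by four powers `a^{−tᵢ}`, `tᵢ > 3`.  §5 the frame instance and the HEAD
`hWhol_of_std`.  References: [Shimura1997, §16.4, §18.4]; [Shimura1982, §1 (1.26)]; [KudlaRallis1994, §1]; [Knapp1986, Ch. VII §1].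
HONEST LABEL.  Count-neutral helper; it discharges the by-value letter `hWhol` of the (KW-arch-hW) dispatcher and nothing more: `HC_CM` is proved only modulo the 7 printed
citations (2 remaining named inputs: hLiu418 = `stmt-HodgeConjecture-24832`, h413 = `stmt-HodgeConjecture-24833`) until rung 0 closes.
-/

set_option autoImplicit false
set_option linter.dupNamespace false -- the mandated namespace repeats `HodgeConjecture.HodgeConjecture`

noncomputable section

open Complex Matrix MeasureTheory Filter
open scoped ComplexConjugate ComplexOrder Topology

namespace Summit.HodgeConjecture.HodgeConjecture.Cruxes.HLiu418.K2LiuKindWArchWhittakerHolomorphy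

open Literature.NumberTheory.ModularForms.SiegelUpperHalfSpace (denom moeb)
open Summit.HodgeConjecture.HodgeConjecture.Cruxes.HLiu418.K2LiuHermTwoGammaDefs (hermTwo)
open Summit.HodgeConjecture.HodgeConjecture.Cruxes.HLiu418.K2LiuHermTwoConfluentXiDefs (trace_mul_hermTwo_of_isHermitian)
open Summit.HodgeConjecture.HodgeConjecture.Cruxes.HLiu418.K2LiuHermitianTubeCocycle (mul_mem_UJ J_mem isUnit_det_denom posDef_im_moeb
  posDef_im_I_smul_one isHermitian_re re_add_I_smul_im)
open Summit.HodgeConjecture.HodgeConjecture.Cruxes.HLiu418.K2LiuArchInducedTubeDefs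
open Summit.HodgeConjecture.HodgeConjecture.Cruxes.HLiu418.K2LiuArchInducedTubeSectionPrelims (det_denom_mul_of_siegel det_toBlocks₂₂_of_mem_siegel)
open Summit.HodgeConjecture.HodgeConjecture.Cruxes.HLiu418.K2LiuArchIntertwiningScalarValue (hermOfReal_eq_hermTwo)
open Summit.HodgeConjecture.HodgeConjecture.Cruxes.HLiu418.K2LiuArchIntertwiningMajorant (integrable_norm_det_hermOfReal_add_rpow_neg continuous_det_denom)
open Summit.HodgeConjecture.HodgeConjecture.Cruxes.HLiu418.K2LiuArchIntertwiningLieDerivativePrelims (denom_transl_eq_mul continuous_hermOfReal)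
open Summit.HodgeConjecture.HodgeConjecture.Cruxes.HLiu418.K2LiuU22ShilovCoordinate (denom_kU_I kU_mem_UJ)
open Summit.HodgeConjecture.HodgeConjecture.Cruxes.HLiu418.K2LiuU22CompactPictureDefs
open Summit.HodgeConjecture.HodgeConjecture.Cruxes.HLiu418.K2LiuArchKFiniteSectionMajorised (exists_norm_apply_le continuousOn_UJ norm_det_eq_one_of_unitary)

/-! ## §1 An elementary real bound -/

-- `x^{−a} ≤ x^{−a₁} + x^{−a₂}` for `a ∈ [a₁, a₂]` is ★ `Literature.Dynamics.TransferOperators.rpow_neg_le_add` (imported).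

/-- `|log x| ≤ (x^η + x^{−η})∕η` for `x > 0`, `η > 0` (`η·log x = log x^η ≤ x^η` and `−η·log x = log x^{−η} ≤ x^{−η}`). [folklore] -/
theorem abs_log_le_rpow_add_rpow {x η : ℝ} (hx : 0 < x) (hη : 0 < η) :
    |Real.log x| ≤ (x ^ η + x ^ (-η)) / η := by
  have h1 : η * Real.log x ≤ x ^ η := by
    rw [← Real.log_rpow hx]
    exact (Real.log_le_sub_one_of_pos (Real.rpow_pos_of_pos hx η)).trans (by linarith)
  have h2 : -η * Real.log x ≤ x ^ (-η) := by
    rw [← Real.log_rpow hx]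
    exact (Real.log_le_sub_one_of_pos (Real.rpow_pos_of_pos hx _)).trans (by linarith)
  have h3 : 0 ≤ x ^ η := Real.rpow_nonneg hx.le _
  have h4 : 0 ≤ x ^ (-η) := Real.rpow_nonneg hx.le _
  rw [le_div_iff₀ hη]
  rcases le_or_gt 0 (Real.log x) with hl | hl
  · rw [abs_of_nonneg hl]; nlinarith
  · rw [abs_of_neg hl]; nlinarith

/-! ## §2 The flat family through a Siegel section -/

/-- **THE FLAT FAMILY IS A SIEGEL SECTION AT EVERY PARAMETER.**  For `F₀ ∈ I_w(s′, χ)` (any `χ`, generic rank `l`) and any `s`, the function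
`G s y := ‖j(y, i1)‖^{2(s′−s)} · F₀ y` (`j(y, i1) = det (denom y (i1))`, principal power of a non-negative real base) satisfies the parabolic law of
`I_w(s, χ)`: for `p ∈ U(J) ∩ P_Δ`, `j(p g, i1) = det p₂₂ · j(g, i1)` (★ `det_denom_mul_of_siegel`) and `‖det p₂₂‖ = ‖det p₁₁‖⁻¹`
(★ `det_toBlocks₂₂_of_mem_siegel`), so the extra factor `‖det p₁₁‖^{2(s−s′)}` converts `‖det p₁₁‖^{2s′+l}` into `‖det p₁₁‖^{2s+l}`.
[cite: Shimura1997, §16.4] [cite: Knapp1986, Ch. VII §1] -/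
theorem isArchSiegelSection_flat {l : Type*} [Fintype l] [DecidableEq l] {χ : ℂ → ℂ} {s' : ℂ} {F₀ : Matrix (l ⊕ l) (l ⊕ l) ℂ → ℂ}
    (hF₀ : IsArchSiegelSection χ s' F₀) (s : ℂ) :
    IsArchSiegelSection χ s (fun y : Matrix (l ⊕ l) (l ⊕ l) ℂ =>
      (((‖(denom y (I • (1 : Matrix l l ℂ))).det‖ : ℝ) : ℂ) ^ (2 * (s' - s))) * F₀ y) := by
  intro p g hP hp
  obtain ⟨hne, h22⟩ := det_toBlocks₂₂_of_mem_siegel hP hp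
  set δ : ℝ := ‖p.toBlocks₁₁.det‖ with hδ
  have hδpos : 0 < δ := norm_pos_iff.2 hne
  have hδ0 : ((δ : ℝ) : ℂ) ≠ 0 := by exact_mod_cast hδpos.ne'
  have harg : ((δ : ℝ) : ℂ).arg ≠ Real.pi := by
    rw [Complex.arg_ofReal_of_nonneg hδpos.le]; exact Real.pi_ne_zero.symm
  have h22n : ‖p.toBlocks₂₂.det‖ = δ⁻¹ := by
    rw [h22, norm_inv, Complex.norm_conj]
  beta_reduce
  rw [hF₀ p g hP hp, det_denom_mul_of_siegel hp, norm_mul, h22n, Complex.ofReal_mul,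
    Complex.mul_cpow_ofReal_nonneg (inv_nonneg.2 hδpos.le) (norm_nonneg _), Complex.ofReal_inv, Complex.inv_cpow _ _ harg]
  -- `δ^{2s′+l} = δ^{2(s′−s)} · δ^{2s+l}`
  have hsplit : ((δ : ℝ) : ℂ) ^ (2 * s' + (Fintype.card l : ℂ)) =
      ((δ : ℝ) : ℂ) ^ (2 * (s' - s)) * ((δ : ℝ) : ℂ) ^ (2 * s + (Fintype.card l : ℂ)) := by
    rw [← Complex.cpow_add _ _ hδ0]
    congr 1
    ring
  have hz : ((δ : ℝ) : ℂ) ^ (2 * (s' - s)) ≠ 0 := by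
    rw [Ne, Complex.cpow_eq_zero_iff, not_and_or]
    exact Or.inl hδ0
  rw [hsplit]
  field_simp

/-- **THE FLAT FAMILY HAS THE SAME COMPACT PICTURE**: at `k_v` (`v` unitary) `j(k_v, i1) = det v` has modulus `1` (★ `denom_kU_I`,
★ `norm_det_eq_one_of_unitary`), so the factor `‖j(k_v, i1)‖^{2(s′−s)}` is `1`. [cite: Knapp1986, Ch. VII §1] -/
theorem flat_kU {s' s : ℂ} {F₀ : Matrix (Fin 2 ⊕ Fin 2) (Fin 2 ⊕ Fin 2) ℂ → ℂ} {Q : Carrier}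
    (hF₀Q : ∀ (v : Matrix (Fin 2) (Fin 2) ℂ), vᴴ * v = 1 → ∀ hv : v.det ≠ 0,
      F₀ ((2 : ℂ)⁻¹ • fromBlocks (1 + v) (-(I • (1 - v))) (I • (1 - v)) (1 + v) : Matrix (Fin 2 ⊕ Fin 2) (Fin 2 ⊕ Fin 2) ℂ) = evalAt v hv Q)
    (v : Matrix (Fin 2) (Fin 2) ℂ) (hv : vᴴ * v = 1) (hv' : v.det ≠ 0) :
    (fun y : Matrix (Fin 2 ⊕ Fin 2) (Fin 2 ⊕ Fin 2) ℂ =>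
      (((‖(denom y (I • (1 : Matrix (Fin 2) (Fin 2) ℂ))).det‖ : ℝ) : ℂ) ^ (2 * (s' - s))) * F₀ y)
      ((2 : ℂ)⁻¹ • fromBlocks (1 + v) (-(I • (1 - v))) (I • (1 - v)) (1 + v) : Matrix (Fin 2 ⊕ Fin 2) (Fin 2 ⊕ Fin 2) ℂ) = evalAt v hv' Q := by
  beta_reduce
  rw [denom_kU_I, norm_det_eq_one_of_unitary hv, Complex.ofReal_one, Complex.one_cpow, one_mul, hF₀Q v hv hv']

/-! ## §3 The twisted integrand at the anti-diagonal frame -/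

/-- The Levi `m′ = diag(−B, C)` behind an anti-diagonal `x = (0 B; C 0)`: `m′ · J = x`. [cite: Shimura1997, §5.1] -/
theorem levi_mul_J (B C : Matrix (Fin 2) (Fin 2) ℂ) :
    (fromBlocks (-B) 0 0 C : Matrix (Fin 2 ⊕ Fin 2) (Fin 2 ⊕ Fin 2) ℂ) * Matrix.J (Fin 2) ℂ = fromBlocks 0 B C 0 := by
  rw [show Matrix.J (Fin 2) ℂ = fromBlocks 0 (-1) 1 0 from rfl, fromBlocks_multiply]
  simp

/-- **THE AUTOMORPHY FACTOR AT THE FRAME**: for `x = (0 B; C 0)`, `g ∈ U(J)` and any `X`,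
`‖j(x · n(X) · g, i1)‖ = ‖det C‖ · (‖det(X + Z)‖ · ‖det d‖)`, `Z = g·i1`, `d = denom g (i1)` (★ `det_denom_mul_of_siegel` at `m′`,
★ `denom_transl_eq_mul`). [cite: Shimura1997, §5.2] -/
theorem norm_det_denom_frame (B C : Matrix (Fin 2) (Fin 2) ℂ)
    {g : Matrix (Fin 2 ⊕ Fin 2) (Fin 2 ⊕ Fin 2) ℂ} (hg : gᴴ * Matrix.J (Fin 2) ℂ * g = Matrix.J (Fin 2) ℂ) (X : Matrix (Fin 2) (Fin 2) ℂ) :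
    ‖(denom ((fromBlocks 0 B C 0 : Matrix (Fin 2 ⊕ Fin 2) (Fin 2 ⊕ Fin 2) ℂ) * fromBlocks 1 X 0 1 * g) (I • (1 : Matrix (Fin 2) (Fin 2) ℂ))).det‖ =
      ‖C.det‖ * (‖(X + moeb g (I • (1 : Matrix (Fin 2) (Fin 2) ℂ))).det‖ * ‖(denom g (I • (1 : Matrix (Fin 2) (Fin 2) ℂ))).det‖) := by
  have hdu : IsUnit (denom g (I • (1 : Matrix (Fin 2) (Fin 2) ℂ))).det := isUnit_det_denom hg posDef_im_I_smul_one
  have hassoc : (fromBlocks 0 B C 0 : Matrix (Fin 2 ⊕ Fin 2) (Fin 2 ⊕ Fin 2) ℂ) * fromBlocks 1 X 0 1 * g =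
      (fromBlocks (-B) 0 0 C : Matrix (Fin 2 ⊕ Fin 2) (Fin 2 ⊕ Fin 2) ℂ) * (Matrix.J (Fin 2) ℂ * fromBlocks 1 X 0 1 * g) := by
    rw [← levi_mul_J]; simp only [Matrix.mul_assoc]
  rw [hassoc, det_denom_mul_of_siegel (by rw [toBlocks_fromBlocks₂₁]) , toBlocks_fromBlocks₂₂, denom_transl_eq_mul X hdu, norm_mul, det_mul, norm_mul]

/-- The frame point `x · n(hermOfReal r) · g` lies in `U(J)`. [cite: Shimura1997, §5.1] -/
theorem frame_mem_UJ {B C : Matrix (Fin 2) (Fin 2) ℂ}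
    (hx : (fromBlocks 0 B C 0 : Matrix (Fin 2 ⊕ Fin 2) (Fin 2 ⊕ Fin 2) ℂ)ᴴ * Matrix.J (Fin 2) ℂ * (fromBlocks 0 B C 0 : Matrix (Fin 2 ⊕ Fin 2) (Fin 2 ⊕ Fin 2) ℂ) =
      Matrix.J (Fin 2) ℂ)
    {g : Matrix (Fin 2 ⊕ Fin 2) (Fin 2 ⊕ Fin 2) ℂ} (hg : gᴴ * Matrix.J (Fin 2) ℂ * g = Matrix.J (Fin 2) ℂ) (r : Fin 2 → Fin 2 → ℝ) :
    ((fromBlocks 0 B C 0 : Matrix (Fin 2 ⊕ Fin 2) (Fin 2 ⊕ Fin 2) ℂ) * fromBlocks 1 (hermOfReal r) 0 1 * g)ᴴ * Matrix.J (Fin 2) ℂ *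
      ((fromBlocks 0 B C 0 : Matrix (Fin 2 ⊕ Fin 2) (Fin 2 ⊕ Fin 2) ℂ) * fromBlocks 1 (hermOfReal r) 0 1 * g) = Matrix.J (Fin 2) ℂ :=
  mul_mem_UJ (mul_mem_UJ hx ((K2LiuHermitianTubeCocycle.transl_mem_iff _).2 (conjTranspose_hermOfReal r))) hg

/-- `r ↦ x · n(hermOfReal r) · g` is continuous. [folklore] -/
theorem continuous_frame (x g : Matrix (Fin 2 ⊕ Fin 2) (Fin 2 ⊕ Fin 2) ℂ) :
    Continuous fun r : Fin 2 → Fin 2 → ℝ => x * fromBlocks 1 (hermOfReal r) 0 1 * g :=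
  (continuous_const.matrix_mul
    (Continuous.matrix_fromBlocks continuous_const continuous_hermOfReal continuous_const continuous_const)).matrix_mul continuous_const

/-- **THE INTEGRABLE MAJORANTS**: for `x = (0 B; C 0)`, `g ∈ U(J)`, `t > 3`, `r ↦ ‖j(x·n(hermOfReal r)·g, i1)‖^{−t}` is integrable on `ℝ^{2×2}` — it is
`(‖det C‖‖det d‖)^{−t}·‖det(hermOfReal r + Z)‖^{−t}`, `Z = U₀ + iV₀`, `V₀ > 0` (★ (L-ii) `integrable_norm_det_hermOfReal_add_rpow_neg`). [cite: Shimura1982, §1 (1.26)] -/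
theorem integrable_rpow_neg_norm_det_denom_frame (B C : Matrix (Fin 2) (Fin 2) ℂ)
    {g : Matrix (Fin 2 ⊕ Fin 2) (Fin 2 ⊕ Fin 2) ℂ} (hg : gᴴ * Matrix.J (Fin 2) ℂ * g = Matrix.J (Fin 2) ℂ) {t : ℝ} (ht : 3 < t) :
    Integrable (fun r : Fin 2 → Fin 2 → ℝ =>
      ‖(denom ((fromBlocks 0 B C 0 : Matrix (Fin 2 ⊕ Fin 2) (Fin 2 ⊕ Fin 2) ℂ) * fromBlocks 1 (hermOfReal r) 0 1 * g) (I • (1 : Matrix (Fin 2) (Fin 2) ℂ))).det‖ ^ (-t)) := by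
  set Z : Matrix (Fin 2) (Fin 2) ℂ := moeb g (I • (1 : Matrix (Fin 2) (Fin 2) ℂ)) with hZ
  have hmaj : Integrable (fun r : Fin 2 → Fin 2 → ℝ => ‖(hermOfReal r + Z).det‖ ^ (-t)) := by
    have h1 := integrable_norm_det_hermOfReal_add_rpow_neg (isHermitian_re Z) (posDef_im_moeb hg posDef_im_I_smul_one) ht
    rwa [re_add_I_smul_im Z] at h1
  refine (hmaj.const_mul ((‖C.det‖ * ‖(denom g (I • (1 : Matrix (Fin 2) (Fin 2) ℂ))).det‖) ^ (-t))).congr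
    (Eventually.of_forall fun r => ?_)
  simp only
  rw [norm_det_denom_frame B C hg, show ‖C.det‖ * (‖(hermOfReal r + Z).det‖ * ‖(denom g (I • (1 : Matrix (Fin 2) (Fin 2) ℂ))).det‖) =
    (‖C.det‖ * ‖(denom g (I • (1 : Matrix (Fin 2) (Fin 2) ℂ))).det‖) * ‖(hermOfReal r + Z).det‖ by ring,
    Real.mul_rpow (mul_nonneg (norm_nonneg _) (norm_nonneg _)) (norm_nonneg _)]

/-- **THE TWIST IS UNIMODULAR ON `Herm₂`**: for `hidx` hermitian, `‖e(−tr(hidx · hermOfReal r))‖ = 1` (the trace of a product of two hermitian matrices is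
real: ★ `hermOfReal_eq_hermTwo`, ★ `trace_mul_hermTwo_of_isHermitian`). [folklore] -/
theorem norm_cexp_trace_hermOfReal {hidx : Matrix (Fin 2) (Fin 2) ℂ} (hh : hidxᴴ = hidx) (r : Fin 2 → Fin 2 → ℝ) :
    ‖cexp (-(2 * Real.pi * I) * (hidx * hermOfReal r).trace)‖ = 1 := by
  have hh' : hidx.IsHermitian := hh
  rw [hermOfReal_eq_hermTwo, trace_mul_hermTwo_of_isHermitian hh', Complex.norm_exp]
  simp

/-! ## §4 Differentiation under the integral sign -/

/-- `|log a| · a^{−τ} ≤ η⁻¹ · (a^{−(t₁−η)} + a^{−(t₂−η)} + a^{−(t₁+η)} + a^{−(t₂+η)})` for `a > 0`, `η > 0`, `t₁ ≤ τ ≤ t₂` (§1). [folklore] -/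
theorem abs_log_mul_rpow_neg_le {a η τ t₁ t₂ : ℝ} (ha : 0 < a) (hη : 0 < η) (h₁ : t₁ ≤ τ) (h₂ : τ ≤ t₂) :
    |Real.log a| * a ^ (-τ) ≤ η⁻¹ * (a ^ (-(t₁ - η)) + a ^ (-(t₂ - η)) + a ^ (-(t₁ + η)) + a ^ (-(t₂ + η))) := by
  have hl := abs_log_le_rpow_add_rpow ha hη
  have hp := Literature.Dynamics.TransferOperators.rpow_neg_le_add ha h₁ h₂
  have e1 : a ^ (-(t₁ - η)) = a ^ η * a ^ (-t₁) := by rw [show -(t₁ - η) = η + -t₁ by ring, Real.rpow_add ha]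
  have e2 : a ^ (-(t₂ - η)) = a ^ η * a ^ (-t₂) := by rw [show -(t₂ - η) = η + -t₂ by ring, Real.rpow_add ha]
  have e3 : a ^ (-(t₁ + η)) = a ^ (-η) * a ^ (-t₁) := by rw [show -(t₁ + η) = -η + -t₁ by ring, Real.rpow_add ha]
  have e4 : a ^ (-(t₂ + η)) = a ^ (-η) * a ^ (-t₂) := by rw [show -(t₂ + η) = -η + -t₂ by ring, Real.rpow_add ha]
  calc |Real.log a| * a ^ (-τ) ≤ (a ^ η + a ^ (-η)) / η * (a ^ (-t₁) + a ^ (-t₂)) :=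
        mul_le_mul hl hp (Real.rpow_nonneg ha.le _) (div_nonneg (add_nonneg (Real.rpow_nonneg ha.le _) (Real.rpow_nonneg ha.le _)) hη.le)
    _ = η⁻¹ * (a ^ (-(t₁ - η)) + a ^ (-(t₂ - η)) + a ^ (-(t₁ + η)) + a ^ (-(t₂ + η))) := by
        rw [e1, e2, e3, e4, div_eq_mul_inv]
        ring

/-- **DOMINATED HOLOMORPHY OF `s ↦ ∫ a(r)^{2(s′−s)} ψ(r) dμ`** (abstract form of §4).  Data: a positive weight `a`, an integrand `ψ` with
`‖ψ r‖ ≤ C · a(r)^{−(2 re s′ + 2)}`, and the integrability of `a^{−t}` for every `t > 3`.  Then at every `s₀` with `re s₀ > ½` the parametric integral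
has the complex derivative `∫ a^{2(s′−s₀)} · log a · (−2) · ψ dμ`: the integrand is `O(a^{−(2σ+2)})`, its `s`-derivative `O(|log a| a^{−(2σ+2)})`, dominated on
`ball s₀ ε` (`ε = η = (σ₀ − ½)∕2`) by `2Cη⁻¹ Σᵢ a^{−tᵢ}` with `tᵢ ∈ {2(σ₀ ∓ ε) + 2 ∓ η} ⊂ (3, ∞)` (Mathlib `hasDerivAt_integral_of_dominated_loc_of_deriv_le`).
[cite: Shimura1982, §1 (1.26)] [cite: Shimura1997, §16.4] -/
theorem hasDerivAt_integral_cpow_mul {α : Type*} [MeasurableSpace α] (μ : Measure α) {a : α → ℝ} (ha : ∀ r, 0 < a r) {ψ : α → ℂ}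
    {C : ℝ} (hC : 0 ≤ C) {s' : ℂ} (hψ : ∀ r, ‖ψ r‖ ≤ C * a r ^ (-(2 * s'.re + 2)))
    (hint : ∀ t : ℝ, 3 < t → Integrable (fun r => a r ^ (-t)) μ) {s₀ : ℂ} (hs₀ : 1 / 2 < s₀.re)
    (hFm : ∀ s : ℂ, AEStronglyMeasurable (fun r => (((a r : ℝ) : ℂ) ^ (2 * (s' - s))) * ψ r) μ)
    (hF'm : AEStronglyMeasurable (fun r => ((a r : ℝ) : ℂ) ^ (2 * (s' - s₀)) * Complex.log ((a r : ℝ) : ℂ) * (2 * -1) * ψ r) μ) :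
    HasDerivAt (fun s : ℂ => ∫ r, (((a r : ℝ) : ℂ) ^ (2 * (s' - s))) * ψ r ∂μ)
      (∫ r, ((a r : ℝ) : ℂ) ^ (2 * (s' - s₀)) * Complex.log ((a r : ℝ) : ℂ) * (2 * -1) * ψ r ∂μ) s₀ := by
  -- constants
  set σ₀ : ℝ := s₀.re with hσ₀
  set ε : ℝ := (σ₀ - 1 / 2) / 2 with hε
  have hεpos : 0 < ε := by rw [hε]; linarith
  set t₁ : ℝ := 2 * (σ₀ - ε) + 2 with ht₁
  set t₂ : ℝ := 2 * (σ₀ + ε) + 2 with ht₂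
  have ht₁3 : 3 < t₁ - ε := by rw [ht₁, hε]; linarith
  have ht₂3 : 3 < t₂ - ε := by rw [ht₂, hε]; linarith
  have ht₁3' : 3 < t₁ + ε := by linarith
  have ht₂3' : 3 < t₂ + ε := by linarith
  -- pointwise facts
  have ha0 : ∀ r, ((a r : ℝ) : ℂ) ≠ 0 := fun r => by exact_mod_cast (ha r).ne'
  have hre : ∀ s : ℂ, (2 * (s' - s)).re = 2 * (s'.re - s.re) := fun s => by
    rw [show (2 : ℂ) = ((2 : ℝ) : ℂ) by norm_num, Complex.re_ofReal_mul, Complex.sub_re]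
  have hnorm_pow : ∀ (s : ℂ) r, ‖((a r : ℝ) : ℂ) ^ (2 * (s' - s))‖ = a r ^ (2 * (s'.re - s.re)) := fun s r => by
    rw [Complex.norm_cpow_eq_rpow_re_of_pos (ha r), hre]
  have hnorm_log : ∀ r, ‖Complex.log ((a r : ℝ) : ℂ)‖ = |Real.log (a r)| := fun r => by
    rw [← Complex.ofReal_log (ha r).le, Complex.norm_real, Real.norm_eq_abs]
  have h2 : ‖(2 : ℂ) * -1‖ = 2 := by simp
  -- the integrand is `O(a^{−(2σ+2)})`
  have hFle : ∀ (s : ℂ) r, ‖(((a r : ℝ) : ℂ) ^ (2 * (s' - s))) * ψ r‖ ≤ C * a r ^ (-(2 * s.re + 2)) := fun s r => by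
    rw [norm_mul, hnorm_pow]
    calc a r ^ (2 * (s'.re - s.re)) * ‖ψ r‖ ≤ a r ^ (2 * (s'.re - s.re)) * (C * a r ^ (-(2 * s'.re + 2))) :=
          mul_le_mul_of_nonneg_left (hψ r) (Real.rpow_nonneg (ha r).le _)
      _ = C * (a r ^ (2 * (s'.re - s.re)) * a r ^ (-(2 * s'.re + 2))) := by ring
      _ = C * a r ^ (-(2 * s.re + 2)) := by
          rw [← Real.rpow_add (ha r)]
          congr 1; congr 1; ring
  -- the derivative is `O(|log a| · a^{−(2σ+2)})`
  have hF'le : ∀ (s : ℂ) r, ‖((a r : ℝ) : ℂ) ^ (2 * (s' - s)) * Complex.log ((a r : ℝ) : ℂ) * (2 * -1) * ψ r‖ ≤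
      2 * C * (|Real.log (a r)| * a r ^ (-(2 * s.re + 2))) := fun s r => by
    rw [norm_mul, norm_mul, norm_mul, hnorm_pow, hnorm_log, h2]
    calc a r ^ (2 * (s'.re - s.re)) * |Real.log (a r)| * 2 * ‖ψ r‖
        ≤ a r ^ (2 * (s'.re - s.re)) * |Real.log (a r)| * 2 * (C * a r ^ (-(2 * s'.re + 2))) :=
          mul_le_mul_of_nonneg_left (hψ r) (mul_nonneg (mul_nonneg (Real.rpow_nonneg (ha r).le _) (abs_nonneg _)) zero_le_two)
      _ = 2 * C * (|Real.log (a r)| * (a r ^ (2 * (s'.re - s.re)) * a r ^ (-(2 * s'.re + 2)))) := by ring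
      _ = 2 * C * (|Real.log (a r)| * a r ^ (-(2 * s.re + 2))) := by
          rw [← Real.rpow_add (ha r)]
          congr 1; congr 1; congr 1; ring
  refine (hasDerivAt_integral_of_dominated_loc_of_deriv_le (μ := μ)
    (F := fun s r => (((a r : ℝ) : ℂ) ^ (2 * (s' - s))) * ψ r)
    (F' := fun s r => ((a r : ℝ) : ℂ) ^ (2 * (s' - s)) * Complex.log ((a r : ℝ) : ℂ) * (2 * -1) * ψ r)
    (bound := fun r => 2 * C * (ε⁻¹ * (a r ^ (-(t₁ - ε)) + a r ^ (-(t₂ - ε)) + a r ^ (-(t₁ + ε)) + a r ^ (-(t₂ + ε)))))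
    (Metric.ball_mem_nhds s₀ hεpos) ?_ ?_ hF'm ?_ ?_ ?_).2
  · -- measurability of `F s` near `s₀`
    exact Eventually.of_forall fun s => hFm s
  · -- integrability at `s₀`
    refine Integrable.mono' ((hint (2 * σ₀ + 2) (by linarith)).const_mul C) (hFm s₀) (Eventually.of_forall fun r => ?_)
    exact hFle s₀ r
  · -- THE DOMINATION on the ball
    refine Eventually.of_forall fun r s hs => ?_
    have hsd : |s.re - σ₀| < ε := by
      rw [hσ₀, ← Complex.sub_re]
      exact lt_of_le_of_lt (Complex.abs_re_le_norm _) (by rwa [← dist_eq_norm])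
    have hτ₁ : t₁ ≤ 2 * s.re + 2 := by rw [ht₁]; linarith [neg_abs_le (s.re - σ₀)]
    have hτ₂ : 2 * s.re + 2 ≤ t₂ := by rw [ht₂]; linarith [le_abs_self (s.re - σ₀)]
    exact (hF'le s r).trans (mul_le_mul_of_nonneg_left (abs_log_mul_rpow_neg_le (ha r) hεpos hτ₁ hτ₂) (by positivity))
  · -- integrability of the bound
    exact ((((hint _ ht₁3).add (hint _ ht₂3)).add (hint _ ht₁3')).add (hint _ ht₂3')).const_mul _ |>.const_mul _
  · -- the pointwise derivative
    refine Eventually.of_forall fun r s _ => ?_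
    have h := ((((hasDerivAt_id' s).const_sub s').const_mul (2 : ℂ)).const_cpow (Or.inl (ha0 r))).mul_const (ψ r)
    exact h

/-! ## §5 The twisted flat family at the frame, and the HEAD -/

/-- **THE TWISTED BIG-CELL INTEGRAL OF THE FLAT FAMILY IS HOLOMORPHIC ON `{½ < re s}`.**  For a section `F₀ ∈ I_w(s′, χ_k)` with compact picture `Q`,
the frame `x = (0 B; C 0) ∈ U(J)`, `g ∈ U(J)`, a hermitian index `hidx` and the twist `e(b) = e(−tr(hidx·b))`:
`s ↦ ∫_r ‖j(y_r,i1)‖^{2(s′−s)} F₀(y_r) · e(hermOfReal r) dr` (`y_r = x·n(hermOfReal r)·g`) is complex-differentiable on `{½ < re s}` — §4 with the weight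
`a(r) = ‖j(y_r, i1)‖ > 0` (§3), ★ FILE 2's majorant of `F₀` and continuity on `U(J)`, §3's integrable powers and unimodular twist.
[cite: Shimura1997, §16.4, §18.4] [cite: KudlaRallis1994, §1] -/
theorem differentiableOn_twistedFlat (k : ℤ) {s' : ℂ} {F₀ : Matrix (Fin 2 ⊕ Fin 2) (Fin 2 ⊕ Fin 2) ℂ → ℂ}
    (hF₀ : IsArchSiegelSection (fun z : ℂ => (conj z / ((‖z‖ : ℝ) : ℂ)) ^ k) s' F₀) (Q : Carrier)
    (hF₀Q : ∀ (v : Matrix (Fin 2) (Fin 2) ℂ), vᴴ * v = 1 → ∀ hv : v.det ≠ 0,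
      F₀ ((2 : ℂ)⁻¹ • fromBlocks (1 + v) (-(I • (1 - v))) (I • (1 - v)) (1 + v) : Matrix (Fin 2 ⊕ Fin 2) (Fin 2 ⊕ Fin 2) ℂ) = evalAt v hv Q)
    {B C : Matrix (Fin 2) (Fin 2) ℂ}
    (hx : (fromBlocks 0 B C 0 : Matrix (Fin 2 ⊕ Fin 2) (Fin 2 ⊕ Fin 2) ℂ)ᴴ * Matrix.J (Fin 2) ℂ * (fromBlocks 0 B C 0 : Matrix (Fin 2 ⊕ Fin 2) (Fin 2 ⊕ Fin 2) ℂ) =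
      Matrix.J (Fin 2) ℂ)
    {g : Matrix (Fin 2 ⊕ Fin 2) (Fin 2 ⊕ Fin 2) ℂ} (hg : gᴴ * Matrix.J (Fin 2) ℂ * g = Matrix.J (Fin 2) ℂ)
    {hidx : Matrix (Fin 2) (Fin 2) ℂ} (hh : hidxᴴ = hidx) {e : Matrix (Fin 2) (Fin 2) ℂ → ℂ}
    (he : ∀ b : Matrix (Fin 2) (Fin 2) ℂ, e b = cexp (-(2 * Real.pi * I) * (hidx * b).trace)) :
    DifferentiableOn ℂ (fun s : ℂ => ∫ r : Fin 2 → Fin 2 → ℝ,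
      (((‖(denom ((fromBlocks 0 B C 0 : Matrix (Fin 2 ⊕ Fin 2) (Fin 2 ⊕ Fin 2) ℂ) * fromBlocks 1 (hermOfReal r) 0 1 * g)
          (I • (1 : Matrix (Fin 2) (Fin 2) ℂ))).det‖ : ℝ) : ℂ) ^ (2 * (s' - s))) *
        F₀ ((fromBlocks 0 B C 0 : Matrix (Fin 2 ⊕ Fin 2) (Fin 2 ⊕ Fin 2) ℂ) * fromBlocks 1 (hermOfReal r) 0 1 * g) * e (hermOfReal r))
      {s : ℂ | 1 / 2 < s.re} := by
  intro s₀ hs₀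
  obtain ⟨C₀, hC₀, hFb⟩ := exists_norm_apply_le k s' hF₀ Q hF₀Q
  have hFc := continuousOn_UJ k s' hF₀ Q hF₀Q
  obtain ⟨a, ha_def⟩ : ∃ a : (Fin 2 → Fin 2 → ℝ) → ℝ, a = fun r =>
      ‖(denom ((fromBlocks 0 B C 0 : Matrix (Fin 2 ⊕ Fin 2) (Fin 2 ⊕ Fin 2) ℂ) * fromBlocks 1 (hermOfReal r) 0 1 * g)
        (I • (1 : Matrix (Fin 2) (Fin 2) ℂ))).det‖ := ⟨_, rfl⟩
  obtain ⟨ψ, hψ_def⟩ : ∃ ψ : (Fin 2 → Fin 2 → ℝ) → ℂ, ψ = fun r =>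
      F₀ ((fromBlocks 0 B C 0 : Matrix (Fin 2 ⊕ Fin 2) (Fin 2 ⊕ Fin 2) ℂ) * fromBlocks 1 (hermOfReal r) 0 1 * g) * e (hermOfReal r) := ⟨_, rfl⟩
  have hyc := continuous_frame (fromBlocks 0 B C 0 : Matrix (Fin 2 ⊕ Fin 2) (Fin 2 ⊕ Fin 2) ℂ) g
  have ha : ∀ r, 0 < a r := fun r => by
    rw [ha_def]
    exact norm_pos_iff.2 (isUnit_det_denom (frame_mem_UJ hx hg r) posDef_im_I_smul_one).ne_zero
  have hψb : ∀ r, ‖ψ r‖ ≤ C₀ * a r ^ (-(2 * s'.re + 2)) := fun r => by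
    rw [hψ_def, ha_def]
    beta_reduce
    rw [norm_mul, he, norm_cexp_trace_hermOfReal hh, mul_one]
    exact hFb _ (frame_mem_UJ hx hg r)
  have hint : ∀ t : ℝ, 3 < t → Integrable (fun r => a r ^ (-t)) := fun t ht => by
    rw [ha_def]
    exact integrable_rpow_neg_norm_det_denom_frame B C hg ht
  -- continuity of the pieces (measurability)
  have hac : Continuous a := by
    rw [ha_def]
    exact (continuous_det_denom.comp hyc).norm
  have haC : Continuous fun r => ((a r : ℝ) : ℂ) := Complex.continuous_ofReal.comp hac
  have hslit : ∀ r, ((a r : ℝ) : ℂ) ∈ Complex.slitPlane := fun r => Complex.ofReal_mem_slitPlane.2 (ha r)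
  have hec : Continuous fun r : Fin 2 → Fin 2 → ℝ => e (hermOfReal r) := by
    have hfe : e = fun b => cexp (-(2 * Real.pi * I) * (hidx * b).trace) := funext he
    rw [hfe]
    exact Complex.continuous_exp.comp (continuous_const.mul ((continuous_const.matrix_mul continuous_hermOfReal).matrix_trace))
  have hψc : Continuous ψ := by
    rw [hψ_def]
    exact (hFc.comp_continuous hyc fun r => frame_mem_UJ hx hg r).mul hec
  have hFm : ∀ s : ℂ, AEStronglyMeasurable (fun r => (((a r : ℝ) : ℂ) ^ (2 * (s' - s))) * ψ r) volume := fun s =>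
    ((haC.cpow continuous_const hslit).mul hψc).aestronglyMeasurable
  have hF'm : AEStronglyMeasurable
      (fun r => ((a r : ℝ) : ℂ) ^ (2 * (s' - s₀)) * Complex.log ((a r : ℝ) : ℂ) * (2 * -1) * ψ r) volume :=
    ((((haC.cpow continuous_const hslit).mul (haC.clog hslit)).mul continuous_const).mul hψc).aestronglyMeasurable
  have hD := (hasDerivAt_integral_cpow_mul volume ha hC₀ hψb hint hs₀ hFm hF'm).differentiableAt
  have hfun : (fun s : ℂ => ∫ r : Fin 2 → Fin 2 → ℝ,
      (((‖(denom ((fromBlocks 0 B C 0 : Matrix (Fin 2 ⊕ Fin 2) (Fin 2 ⊕ Fin 2) ℂ) * fromBlocks 1 (hermOfReal r) 0 1 * g)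
          (I • (1 : Matrix (Fin 2) (Fin 2) ℂ))).det‖ : ℝ) : ℂ) ^ (2 * (s' - s))) *
        F₀ ((fromBlocks 0 B C 0 : Matrix (Fin 2 ⊕ Fin 2) (Fin 2 ⊕ Fin 2) ℂ) * fromBlocks 1 (hermOfReal r) 0 1 * g) * e (hermOfReal r)) =
      fun s : ℂ => ∫ r : Fin 2 → Fin 2 → ℝ, (((a r : ℝ) : ℂ) ^ (2 * (s' - s))) * ψ r := by
    funext s
    rw [ha_def, hψ_def]
    simp only [mul_assoc]
  rw [hfun]
  exact hD.differentiableWithinAt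

/-- **HEAD — THE HOLOMORPHY LETTER `hWhol` OF ★ `K2LiuKindWArchWhittakerLetterDispatch.hW_of_signCases`, PAID** (its binder byte for byte, at generic index
types and every abscissa `s₁ ≥ ½`; hypotheses ⊆ the dispatcher's own frame letters `hx`, `hPt`, index reading `hherm`, `hebr`).  Given `S` (`good S`), `h`, `w`, a
compact picture `Q`, `s′` with `s₁ < re s′` and a section `F₀ ∈ I_w(s′, χ_{k w})` of picture `Q`, the FLAT FAMILY `G s := ‖j(·, i1)‖^{2(s′−s)} · F₀` (§2) is a
section at every `s` with picture `Q`, and its twisted big-cell integral at the frame `(x_w, Pt S h w)` is holomorphic on `{s₁ < re} ⊆ {½ < re}` (§5).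
The consumer instantiates `s₁ := 2∕2` (`by norm_num`). [cite: Shimura1997, §16.4, §18.4] [cite: KudlaRallis1994, §1] [cite: MoeglinWaldspurger1995, IV.1.9] -/
theorem hWhol_of_std {ιS ιh W : Type*} (good : ιS → Prop) (k : W → ℤ)
    (B C : W → Matrix (Fin 2) (Fin 2) ℂ)
    (hx : ∀ w, (fromBlocks 0 (B w) (C w) 0 : Matrix (Fin 2 ⊕ Fin 2) (Fin 2 ⊕ Fin 2) ℂ)ᴴ * Matrix.J (Fin 2) ℂ *
      (fromBlocks 0 (B w) (C w) 0 : Matrix (Fin 2 ⊕ Fin 2) (Fin 2 ⊕ Fin 2) ℂ) = Matrix.J (Fin 2) ℂ)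
    (Pt : ιS → ιh → W → Matrix (Fin 2 ⊕ Fin 2) (Fin 2 ⊕ Fin 2) ℂ) (hPt : ∀ S h w, (Pt S h w)ᴴ * Matrix.J (Fin 2) ℂ * Pt S h w = Matrix.J (Fin 2) ℂ)
    (eb : ιS → ιh → W → Matrix (Fin 2) (Fin 2) ℂ → ℂ) (hidx : ιS → ιh → W → Matrix (Fin 2) (Fin 2) ℂ)
    (hherm : ∀ S h w, (hidx S h w)ᴴ = hidx S h w)
    (hebr : ∀ S h w (b : Matrix (Fin 2) (Fin 2) ℂ), eb S h w b = cexp (-(2 * Real.pi * I) * (hidx S h w * b).trace))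
    (s₁ : ℝ) (hs₁ : 1 / 2 ≤ s₁) :
        ∀ (S : ιS), good S → ∀ (h : ιh) (w : W) (Q : Carrier), ∀ s' : ℂ, s₁ < s'.re → ∀ F₀ : Matrix (Fin 2 ⊕ Fin 2) (Fin 2 ⊕ Fin 2) ℂ → ℂ,
      IsArchSiegelSection (fun z : ℂ => (conj z / ((‖z‖ : ℝ) : ℂ)) ^ (k w)) s' F₀ →
      (∀ (v : Matrix (Fin 2) (Fin 2) ℂ), vᴴ * v = 1 → ∀ hv : v.det ≠ 0,
        F₀ ((2 : ℂ)⁻¹ • fromBlocks (1 + v) (-(I • (1 - v))) (I • (1 - v)) (1 + v) : Matrix (Fin 2 ⊕ Fin 2) (Fin 2 ⊕ Fin 2) ℂ) = evalAt v hv Q) →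
      ∃ G : ℂ → Matrix (Fin 2 ⊕ Fin 2) (Fin 2 ⊕ Fin 2) ℂ → ℂ,
      (∀ s : ℂ, s₁ < s.re → IsArchSiegelSection (fun z : ℂ => (conj z / ((‖z‖ : ℝ) : ℂ)) ^ (k w)) s (G s)) ∧
      (∀ s : ℂ, s₁ < s.re → ∀ (v : Matrix (Fin 2) (Fin 2) ℂ), vᴴ * v = 1 → ∀ hv : v.det ≠ 0,
        G s ((2 : ℂ)⁻¹ • fromBlocks (1 + v) (-(I • (1 - v))) (I • (1 - v)) (1 + v) : Matrix (Fin 2 ⊕ Fin 2) (Fin 2 ⊕ Fin 2) ℂ) = evalAt v hv Q) ∧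
      DifferentiableOn ℂ (fun s : ℂ => ∫ r : Fin 2 → Fin 2 → ℝ,
        G s ((fromBlocks 0 (B w) (C w) 0 : Matrix (Fin 2 ⊕ Fin 2) (Fin 2 ⊕ Fin 2) ℂ) * fromBlocks 1 (hermOfReal r) 0 1 * Pt S h w) * eb S h w (hermOfReal r))
        {s : ℂ | s₁ < s.re} := by
  intro S _ h w Q s' _ F₀ hF₀ hF₀Q
  refine ⟨fun s y => (((‖(denom y (I • (1 : Matrix (Fin 2) (Fin 2) ℂ))).det‖ : ℝ) : ℂ) ^ (2 * (s' - s))) * F₀ y,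
    fun s _ => isArchSiegelSection_flat hF₀ s, fun s _ v hv hv' => flat_kU hF₀Q v hv hv', ?_⟩
  exact (differentiableOn_twistedFlat (k w) hF₀ Q hF₀Q (hx w) (hPt S h w) (hherm S h w) (hebr S h w)).mono
    fun s (hs : s₁ < s.re) => lt_of_le_of_lt hs₁ hs

end Summit.HodgeConjecture.HodgeConjecture.Cruxes.HLiu418.K2LiuKindWArchWhittakerHolomorphy

end
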